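import Mathlib.Logic.Relation
import Mathlib.Data.Set.Basic
import HarnessLib

/-!
# Diodes are an essential enhancement, III-a: directed paths inside a set — entry, exit, gate excision

RSW3 lane (lead, gen 32).  Helper file for `PercDiodeSteering.DiodeEnhancement` (stmt-CriticalPhenomena-7550).  The directed paths of
the resistor–diode model are reflexive–transitive closures `Relation.ReflTransGen (fun x y => R x y ∧ y ∈ A) p q` of a step relation
`R` restricted to a vertex set `A` ("a directed path from `p` to `q` all of whose vertices after `p` lie in `A`").  This file collects the
four combinatorial facts about such paths used by the sealed-window pasting (`…DiodeEnhancementPasting.lean`), for an ARBITRARY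
relation `R` on an arbitrary type (no symmetry is assumed):
* `rtg_induct_inv` — transport of an invariant along a path, re-labelling the steps;
* `rtg_first_entry` — a path from outside `B` either avoids `B` or has a first entry `x → u ∈ B` with the prefix outside `B` and the
  suffix from `u`;
* `rtg_last_exit` — a path from inside `B` to outside `B` has a last exit `v → q'` with the suffix outside `B`;
* `rtg_gate_excision` — if every step touching a trap `T` stays in `T` or involves the gate `g`, a path between two vertices off `T`
  can be re-routed off `T` (each excursion into `T` enters and leaves through `g` and is cut out; this is direction-agnostic).
Def-free.

References: G. Grimmett, *Percolation* (1999), §3.3 (local modification) [GrimmettPercolation1999]; P. Balister, B. Bollobás,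
O. Riordan, arXiv:1402.0834 §2 [BalisterBollobasRiordan2014].
-/

namespace Summit.CriticalPhenomena.PercolationContinuityZ3.Theorems

namespace DiodeEnh

variable {α : Type*}

/-- **Invariant transport**: if `P` holds at the start and every step from a `P`-vertex preserves `P` and is an `R'`-step, then a
restricted `R`-path is a restricted `R'`-path (and `P` holds at the end). [folklore] -/
theorem rtg_induct_inv {R R' : α → α → Prop} {A : Set α} {P : α → Prop} {p q : α} (hp : P p)
    (hstep : ∀ x y, P x → R x y → y ∈ A → P y ∧ R' x y)
    (h : Relation.ReflTransGen (fun x y => R x y ∧ y ∈ A) p q) :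
    P q ∧ Relation.ReflTransGen (fun x y => R' x y ∧ y ∈ A) p q := by
  induction h with
  | refl => exact ⟨hp, Relation.ReflTransGen.refl⟩
  | @tail b c _ hbc ih =>
    obtain ⟨hPc, hR'⟩ := hstep b c ih.1 hbc.1 hbc.2
    exact ⟨hPc, ih.2.tail ⟨hR', hbc.2⟩⟩

/-- Every vertex of a restricted path after the start lies in the restricting set; in particular the end does, unless the path is
trivial. [folklore] -/
theorem rtg_end_mem {R : α → α → Prop} {A : Set α} {p q : α} (h : Relation.ReflTransGen (fun x y => R x y ∧ y ∈ A) p q) :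
    q = p ∨ q ∈ A := by
  induction h with
  | refl => exact Or.inl rfl
  | tail _ hbc _ => exact Or.inr hbc.2

/-- Restricted paths are monotone in the restricting set. [folklore] -/
theorem rtg_mono_set {R : α → α → Prop} {A A' : Set α} (hAA' : A ⊆ A') {p q : α}
    (h : Relation.ReflTransGen (fun x y => R x y ∧ y ∈ A) p q) : Relation.ReflTransGen (fun x y => R x y ∧ y ∈ A') p q := by
  induction h with
  | refl => exact Relation.ReflTransGen.refl
  | tail _ hbc ih => exact ih.tail ⟨hbc.1, hAA' hbc.2⟩

/-- **First entry.**  A restricted path from `p ∉ B` to `q` either never enters `B`, or splits at its first entry: a step `x → u` with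
`x ∉ B` (the prefix `p ⇝ x` outside `B`), `u ∈ B ∩ A`, and the suffix `u ⇝ q`. [folklore] -/
theorem rtg_first_entry {R : α → α → Prop} {A : Set α} (B : Set α) {p q : α} (hp : p ∉ B)
    (h : Relation.ReflTransGen (fun x y => R x y ∧ y ∈ A) p q) :
    Relation.ReflTransGen (fun x y => R x y ∧ y ∈ A ∩ Bᶜ) p q ∨
      ∃ x u, x ∉ B ∧ u ∈ B ∧ u ∈ A ∧ R x u ∧ Relation.ReflTransGen (fun x y => R x y ∧ y ∈ A ∩ Bᶜ) p x ∧
        Relation.ReflTransGen (fun x y => R x y ∧ y ∈ A) u q := by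
  induction h with
  | refl => exact Or.inl Relation.ReflTransGen.refl
  | @tail w w' hpw hww' ih =>
    rcases ih with ih | ⟨x, u, hx, hu, huA, hxu, hpx, huw⟩
    · by_cases hw' : w' ∈ B
      · refine Or.inr ⟨w, w', ?_, hw', hww'.2, hww'.1, ih, Relation.ReflTransGen.refl⟩
        rcases rtg_end_mem ih with rfl | hwA
        · exact hp
        · exact hwA.2
      · exact Or.inl (ih.tail ⟨hww'.1, hww'.2, hw'⟩)
    · exact Or.inr ⟨x, u, hx, hu, huA, hxu, hpx, huw.tail hww'⟩

/-- **Last exit.**  A restricted path from `p ∈ B` to `q ∉ B` splits at its last exit: a step `v → q'` with `v ∈ B`, `q' ∈ A ∖ B`, the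
prefix `p ⇝ v` and the suffix `q' ⇝ q` outside `B`. [folklore] -/
theorem rtg_last_exit {R : α → α → Prop} {A : Set α} (B : Set α) {p q : α} (hp : p ∈ B) (hq : q ∉ B)
    (h : Relation.ReflTransGen (fun x y => R x y ∧ y ∈ A) p q) :
    ∃ v q', v ∈ B ∧ q' ∉ B ∧ q' ∈ A ∧ R v q' ∧ Relation.ReflTransGen (fun x y => R x y ∧ y ∈ A) p v ∧
      Relation.ReflTransGen (fun x y => R x y ∧ y ∈ A ∩ Bᶜ) q' q := by
  induction h with
  | refl => exact absurd hp hq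
  | @tail w w' hpw hww' ih =>
    by_cases hw : w ∈ B
    · exact ⟨w, w', hw, hq, hww'.2, hww'.1, hpw, Relation.ReflTransGen.refl⟩
    · obtain ⟨v, q', hv, hq', hq'A, hvq', hpv, hq'w⟩ := ih hw
      exact ⟨v, q', hv, hq', hq'A, hvq', hpv, hq'w.tail ⟨hww'.1, hww'.2, hq⟩⟩

/-- **Gate excision.**  Let `T` be a trap with gate `g`: every step with an endpoint in `T` has its other endpoint in `T ∪ {g}`.  Then a
restricted path between two vertices off `T` can be re-routed off `T`: each excursion into `T` enters and leaves through `g`, and is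
cut out (the remaining steps are steps of the original path, in their original direction). [cite: BalisterBollobasRiordan2014, §2] -/
theorem rtg_gate_excision {R : α → α → Prop} {A T : Set α} {g : α}
    (hgate : ∀ t ∈ T, ∀ s, (R t s ∨ R s t) → s ∈ T ∨ s = g) {p q : α} (hp : p ∉ T) (hq : q ∉ T)
    (h : Relation.ReflTransGen (fun x y => R x y ∧ y ∈ A) p q) :
    Relation.ReflTransGen (fun x y => R x y ∧ y ∈ A \ T) p q := by
  suffices key : ∀ v, Relation.ReflTransGen (fun x y => R x y ∧ y ∈ A) p v →
      (v ∉ T → Relation.ReflTransGen (fun x y => R x y ∧ y ∈ A \ T) p v) ∧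
        (v ∈ T → Relation.ReflTransGen (fun x y => R x y ∧ y ∈ A \ T) p g) from (key q h).1 hq
  intro v hv
  induction hv with
  | refl => exact ⟨fun _ => Relation.ReflTransGen.refl, fun h => absurd h hp⟩
  | @tail v w _ hvw ih =>
    refine ⟨fun hwT => ?_, fun hwT => ?_⟩
    · by_cases hvT : v ∈ T
      · -- leaving the trap: only through the gate, so `w = g`... no: `w ∉ T`, hence `w = g`; but the path to `g` is the one recorded
        rcases hgate v hvT w (Or.inl hvw.1) with h | h
        · exact absurd h hwT
        · rw [h]; exact ih.2 hvT
      · exact (ih.1 hvT).tail ⟨hvw.1, hvw.2, hwT⟩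
    · by_cases hvT : v ∈ T
      · exact ih.2 hvT
      · -- entering the trap: only from the gate, so `v = g`
        rcases hgate w hwT v (Or.inr hvw.1) with h | h
        · exact absurd h hvT
        · rw [← h]; exact ih.1 hvT

end DiodeEnh

end Summit.CriticalPhenomena.PercolationContinuityZ3.Theorems
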